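import Mathlib
import HarnessLib
import Literature.Analysis.FluidPDE.TypeIAncientMild
import Literature.Analysis.FluidPDE.VorticityCalculus
import Summits.NavierStokesRegularity.NavierStokesRegularity.Theorems.PoloidalWindowDoorPoloidalWindowRigidityWindow
import Summits.NavierStokesRegularity.NavierStokesRegularity.Theorems.PoloidalWindowDoorPoloidalWindowRigidityClebsch
import Summits.NavierStokesRegularity.NavierStokesRegularity.Theorems.PoloidalWindowDoorPoloidalWindowRigidityHotLoopCoreLocated
import Summits.NavierStokesRegularity.NavierStokesRegularity.Theorems.PoloidalWindowDoorPoloidalWindowRigidityLevelTube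

/-!
# Route `PoloidalWindowDoor`, crux `PoloidalWindowRigidity` (K2, stmt-NavierStokesRegularity-19708) — LINE 14 `loop_island`
# (ns-idea-8 g7, lens «barrier»), STUB Z `stub_loopsPersist`: CLOSED VORTEX LINES PERSIST ACROSS NEARBY PLANES

Cell ns-regularity-ideate, seat ns-poloidal-K2-p2 g12 (stub-worker on K2; `--supports` the crux item).  Statement VERBATIM
`Cruxes/PoloidalWindowRigidity/Lines/loop_island.lean` (ad8f96e88fc9) l.168–184.

PROOF.  At time `s < 0` the slice has a smooth planar stream function `ψ` with `curl v(s) = (∂₁ψ, −∂₀ψ, 0)` (tree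
`…Clebsch.exists_clebsch_slice`), so `X := curl v(s)` is the horizontal Hamiltonian field of `ψ`.  Let `Λ = range γ ⊂ P_{z₀}` be the given
non-stationary closed orbit, `c₀ = ψ(γ 0)`.  (1) `…LevelTube.exists_level_tube`: for some `r > 0`, level-`c₀` points of `P_{z₀}` within `r` of
`Λ` lie ON `Λ`; `X ≠ 0` on a `ρ`-thickening of `Λ` (`X ≠ 0` along `Λ`, compactness).  (2) With `r' < min(r, ρ)/2` and the vertical projection
`π` onto `P_{z₀}`, the «tube sphere» `{y₂ = z₀, infDist(y, Λ) = r'}` carries no level point, hence `|ψ − c₀| ≥ η > 0` there (compactness);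
uniform continuity of `ψ` on the compact tube transports this to the planes `P_z`, `|z − z₀| < δ`: no level-`c₀` point of `P_z` has
`infDist(π y, Λ) = r'`.  (3) A level point `p_z ∈ P_z` inside the tube exists by the intermediate value theorem along the shifted normal
segment `σ ↦ γ 0 + σ∇ₕψ(γ 0) + (z − z₀)e₂` (`ψ` is strictly above / below `c₀` at its ends at height `z₀`, and stays so after the small shift).
(4) The located hot-loop lemma `…HotLoopCoreLocated.exists_periodic_orbit_of_isolated_hot_piece_located` with the first integral
`f = −(ψ − c₀)²`, `N = 0`, `K = {y₂ = z, infDist(π y, Λ) ≤ r', ψ = c₀}` (compact, `∋ p_z`, inside the open guard `O = {infDist(π y, Λ) < r'}`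
by (2)) and `X ≠ 0` on `O ∩ P_z` gives a non-stationary periodic orbit of `X` starting in `P_z`.

WHAT THIS IS NOT: not a claim about Navier–Stokes regularity — one provable stub of an ideator line of a door route (bears_on LADDER-NS N0,
rung N0-LocalTubeDoorPoloidal); the line's stub J (Jordan separation) and the residues S0 / HL3′ / NoIslands are not touched; crux 19708 and
items 20428 / 27893 / 22881 stay OPEN.
-/

noncomputable section

-- the summit and its single sub-problem share the name (CONVENTIONS §1), as in every Theorems file
set_option linter.dupNamespace false

namespace Summit.NavierStokesRegularity.NavierStokesRegularity.Theorems.PoloidalWindowDoorPoloidalWindowRigidityLoopsPersist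

open MeasureTheory Set Function Filter Topology Metric
open scoped RealInnerProductSpace InnerProductSpace ContDiff
open Literature.Analysis Literature.Analysis.FluidPDE
open Summit.NavierStokesRegularity.NavierStokesRegularity.Theorems.PoloidalWindowDoorPoloidalWindowRigidityWindow
open Summit.NavierStokesRegularity.NavierStokesRegularity.Theorems.PoloidalWindowDoorPoloidalWindowRigidityClebsch
open Summit.NavierStokesRegularity.NavierStokesRegularity.Theorems.PoloidalWindowDoorPoloidalWindowRigidityHotLoopCoreLocated
open Summit.NavierStokesRegularity.NavierStokesRegularity.Theorems.PoloidalWindowDoorPoloidalWindowRigidityLevelTube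

/-- **Sign of a function near a point with positive derivative**: if `g′(0) > 0` then for some `σ₀ > 0` below any prescribed bound,
`g(−σ₀) < g 0 < g(σ₀)`. [folklore] -/
theorem exists_lt_lt_of_hasDerivAt_pos {g : ℝ → ℝ} {m : ℝ} (hg : HasDerivAt g m 0) (hm : 0 < m) {b : ℝ} (hb : 0 < b) :
    ∃ σ₀ : ℝ, 0 < σ₀ ∧ σ₀ < b ∧ g (-σ₀) < g 0 ∧ g 0 < g σ₀ := by
  have ht := hg.tendsto_slope
  have hev : ∀ᶠ σ in 𝓝[≠] (0 : ℝ), 0 < slope g 0 σ := ht.eventually (lt_mem_nhds hm)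
  have hev' : ∀ᶠ σ in 𝓝 (0 : ℝ), σ ≠ 0 → 0 < (g σ - g 0) / σ := by
    filter_upwards [eventually_nhdsWithin_iff.1 hev] with σ hσ hne
    have h := hσ (mem_compl_singleton_iff.2 hne)
    rwa [slope_def_field, sub_zero] at h
  obtain ⟨τ, hτ, hτp⟩ := Metric.eventually_nhds_iff.1 hev'
  set σ₀ : ℝ := min (τ / 2) (b / 2) with hσ₀
  have hσ₀pos : 0 < σ₀ := lt_min (by positivity) (by positivity)
  have hσ₀τ : σ₀ < τ := lt_of_le_of_lt (min_le_left _ _) (by linarith)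
  refine ⟨σ₀, hσ₀pos, lt_of_le_of_lt (min_le_right _ _) (by linarith), ?_, ?_⟩
  · have h := hτp (y := -σ₀) (by rw [dist_zero_right, norm_neg, Real.norm_eq_abs, abs_of_pos hσ₀pos]; exact hσ₀τ)
      (neg_ne_zero.2 hσ₀pos.ne')
    have : (g (-σ₀) - g 0) / -σ₀ = (g 0 - g (-σ₀)) / σ₀ := by rw [div_neg, ← neg_div, neg_sub]
    rw [this] at h
    have := (div_pos_iff_of_pos_right hσ₀pos).1 h
    linarith
  · have h := hτp (y := σ₀) (by rw [dist_zero_right, Real.norm_eq_abs, abs_of_pos hσ₀pos]; exact hσ₀τ) hσ₀pos.ne'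
    have := (div_pos_iff_of_pos_right hσ₀pos).1 h
    linarith

set_option maxHeartbeats 800000 in
/-- **STUB Z `stub_loopsPersist` of LINE 14 `loop_island` (VERBATIM): closed vortex lines persist across nearby planes.**  See the module
docstring for the proof (one long assembly; the heartbeat bump pays for its many local definitions). -/
theorem stub_loopsPersist :
    ∀ (C : ℝ) (v : ℝ → EuclideanSpace ℝ (Fin 3) → EuclideanSpace ℝ (Fin 3)),
      Literature.Analysis.FluidPDE.HasTypeITimeDecay C v →
      ContinuousOn (Function.uncurry v) (Set.Iio (0 : ℝ) ×ˢ Set.univ) →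
      (∀ s t : ℝ, s < t → t < 0 → ∀ x, v t x =
        Literature.Analysis.UnboundedOperators.heatExtension (v s) (t - s) x -
          Literature.Analysis.FluidPDE.oseenDuhamel 1 s v v t x) →
      (∀ t < 0, Literature.Analysis.FluidPDE.VectorCalculus.IsDivFree (v t)) →
      (∀ s < 0, ∀ y, ⟪Literature.Analysis.FluidPDE.curl (v s) y, EuclideanSpace.single 2 1⟫_ℝ = 0) →
      ∀ s : ℝ, s < 0 → ∀ (γ : ℝ → EuclideanSpace ℝ (Fin 3)) (ℓ : ℝ), 0 < ℓ →
        (∀ θ, HasDerivAt γ (Literature.Analysis.FluidPDE.curl (v s) (γ θ)) θ) → (∀ θ, γ (θ + ℓ) = γ θ) →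
        Literature.Analysis.FluidPDE.curl (v s) (γ 0) ≠ 0 →
        ∃ δ : ℝ, 0 < δ ∧ ∀ z : ℝ, |z - γ 0 2| < δ →
          ∃ (γ' : ℝ → EuclideanSpace ℝ (Fin 3)) (ℓ' : ℝ), 0 < ℓ' ∧
            (∀ θ, HasDerivAt γ' (Literature.Analysis.FluidPDE.curl (v s) (γ' θ)) θ) ∧ (∀ θ, γ' (θ + ℓ') = γ' θ) ∧
            γ' 0 2 = z ∧ Literature.Analysis.FluidPDE.curl (v s) (γ' 0) ≠ 0 := by
  intro C v hrate hcont hmild hdiv hpol s hs γ ℓ hℓ hγ hper hne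
  -- smoothness of the slice and of `X := curl (v s)`
  have hA : IsTypeIAncientMild C v := isTypeIAncientMild_of_class hrate hcont hmild hdiv
  have hvs : ContDiff ℝ (⊤ : ℕ∞) (v s) := hA.contDiff_slice hs
  have hV3 : ContDiff ℝ 3 (v s) := contDiff_infty.1 hvs 3
  have hXc : ContDiff ℝ 2 (curl (v s)) := contDiff_curl (n := 2) (by exact_mod_cast hV3)
  have hX1 : ContDiff ℝ 1 (curl (v s)) := hXc.of_le one_le_two
  have hXcont : Continuous (curl (v s)) := hX1.continuous
  -- the stream function
  obtain ⟨φ, ψ, -, hψ, -, -, -, -, hcomp, -, -, -⟩ := exists_clebsch_slice hrate hcont hmild hdiv hpol hs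
  set X : EuclideanSpace ℝ (Fin 3) → EuclideanSpace ℝ (Fin 3) := curl (v s) with hXdef
  have hXψ0 : ∀ y, X y 0 = fderiv ℝ ψ y (EuclideanSpace.single 1 1) := fun y => (hcomp y).1
  have hXψ1 : ∀ y, X y 1 = -fderiv ℝ ψ y (EuclideanSpace.single 0 1) := fun y => (hcomp y).2.1
  have hX2 : ∀ y, X y 2 = 0 := fun y => (hcomp y).2.2
  have hψ1 : ContDiff ℝ 1 ψ := contDiff_infty.1 hψ 1
  have hψ3 : ContDiff ℝ 3 ψ := contDiff_infty.1 hψ 3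
  have hψc : Continuous ψ := hψ.continuous
  have hψd : Differentiable ℝ ψ := hψ1.differentiable one_ne_zero
  have hψX : ∀ y, fderiv ℝ ψ y (X y) = 0 := hamiltonian_first_integral hXψ0 hXψ1 hX2
  -- the orbit
  have hγc : Continuous γ := continuous_iff_continuousAt.2 fun t => (hγ t).continuousAt
  set Λ : Set (EuclideanSpace ℝ (Fin 3)) := Set.range γ with hΛ
  have hΛc : IsCompact Λ := isCompact_range_of_periodic hγc hℓ hper
  have hΛne : Λ.Nonempty := Set.range_nonempty γ
  set z₀ : ℝ := γ 0 2 with hz₀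
  set c₀ : ℝ := ψ (γ 0) with hc₀
  have hlev : ∀ θ, ψ (γ θ) = c₀ := orbit_level hψ1 hXψ0 hXψ1 hX2 hγ
  have hreg : ∀ θ, X (γ θ) ≠ 0 := field_ne_zero_along_orbit hX1 hγ hℓ hper hne
  obtain ⟨R, hR⟩ := hΛc.isBounded.subset_closedBall 0
  -- (1) the tube radius and the regularity thickening
  obtain ⟨r, hr, htube⟩ := exists_level_tube hψ1 hX1 hXψ0 hXψ1 hX2 hγ hℓ hper hne
  have hopen : IsOpen {y : EuclideanSpace ℝ (Fin 3) | X y ≠ 0} := isOpen_ne_fun hXcont continuous_const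
  obtain ⟨ρ, hρ, hρsub⟩ := hΛc.exists_cthickening_subset_open hopen (by rintro _ ⟨θ, rfl⟩; exact hreg θ)
  set r' : ℝ := min (r / 2) (ρ / 3) with hr'
  have hr'pos : 0 < r' := lt_min (by positivity) (by positivity)
  have hr'r : r' < r := lt_of_le_of_lt (min_le_left _ _) (by linarith)
  have hr'ρ : 2 * r' < ρ := by have := min_le_right (r / 2) (ρ / 3); rw [← hr'] at this; linarith
  -- the vertical projection onto the plane of the orbit and the tube distance
  set e2 : EuclideanSpace ℝ (Fin 3) := EuclideanSpace.single 2 1 with he2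
  set P : EuclideanSpace ℝ (Fin 3) → EuclideanSpace ℝ (Fin 3) := fun y => y - (y 2 - z₀) • e2 with hP
  have hP2 : ∀ y, P y 2 = z₀ := fun y => by simp [hP, he2]
  have hPfix : ∀ y : EuclideanSpace ℝ (Fin 3), y 2 = z₀ → P y = y := fun y hy => by simp [hP, hy]
  have hPdist : ∀ y, dist y (P y) = |y 2 - z₀| := fun y => by
    rw [dist_eq_norm, hP]; simp [he2, norm_smul]
  have hPc : Continuous P := by
    have h2 : Continuous fun y : EuclideanSpace ℝ (Fin 3) => y 2 := (EuclideanSpace.proj (𝕜 := ℝ) (2 : Fin 3)).continuous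
    exact continuous_id.sub ((h2.sub continuous_const).smul continuous_const)
  have hPP : ∀ y, P (P y) = P y := fun y => hPfix _ (hP2 y)
  have hPshift : ∀ (y : EuclideanSpace ℝ (Fin 3)) (w : ℝ), P (y + w • e2) = P y := fun y w => by
    simp only [hP]
    ext i; fin_cases i <;> simp [he2]
  set d : EuclideanSpace ℝ (Fin 3) → ℝ := fun y => infDist (P y) Λ with hd
  have hdc : Continuous d := (continuous_infDist_pt Λ).comp hPc
  have hdP : ∀ y, d (P y) = d y := fun y => by simp only [hd, hPP]
  -- norm control inside the tube
  have hnormP : ∀ y, d y < r' + 1 → ‖P y‖ < R + (r' + 1) := fun y hy => by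
    obtain ⟨x, hx, hxy⟩ := (Metric.infDist_lt_iff hΛne).1 hy
    have hxR : ‖x‖ ≤ R := by simpa using hR hx
    calc ‖P y‖ = ‖(P y - x) + x‖ := by rw [sub_add_cancel]
      _ ≤ ‖P y - x‖ + ‖x‖ := norm_add_le _ _
      _ < r' + 1 + R := by rw [← dist_eq_norm]; linarith
      _ = R + (r' + 1) := by ring
  have hnorm : ∀ y, d y < r' + 1 → |y 2 - z₀| ≤ 1 → ‖y‖ ≤ R + r' + 3 := fun y hy hy2 => by
    have h1 := hnormP y hy
    have h2 : ‖y - P y‖ ≤ 1 := by rw [← dist_eq_norm, hPdist]; exact hy2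
    calc ‖y‖ = ‖(y - P y) + P y‖ := by rw [sub_add_cancel]
      _ ≤ ‖y - P y‖ + ‖P y‖ := norm_add_le _ _
      _ ≤ R + r' + 3 := by linarith
  -- `X ≠ 0` on the solid tube `{d ≤ r', |y₂ - z₀| ≤ r'}`
  have hXtube : ∀ y, d y ≤ r' → |y 2 - z₀| ≤ r' → X y ≠ 0 := by
    intro y hdy hy2
    have hinf : infDist y Λ < ρ := by
      have h1 : infDist y Λ ≤ infDist (P y) Λ + dist y (P y) := infDist_le_infDist_add_dist
      rw [hPdist] at h1
      have : infDist (P y) Λ = d y := rfl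
      linarith
    have hy : y ∈ cthickening ρ Λ :=
      thickening_subset_cthickening ρ Λ ((mem_thickening_iff_infDist_lt hΛne).2 hinf)
    exact hρsub hy
  -- (2) separation on the tube sphere of the plane `P_{z₀}`
  have hsphere : ∀ y : EuclideanSpace ℝ (Fin 3), y 2 = z₀ → d y = r' → ψ y ≠ c₀ := by
    intro y hy hdy hψy
    have hyΛ : y ∈ Λ := htube y hy (by rw [← hPfix y hy]; show d y < r; linarith) hψy
    have : d y = 0 := by simp only [hd, hPfix y hy]; exact infDist_zero_of_mem hyΛ
    linarith
  set S : Set (EuclideanSpace ℝ (Fin 3)) := {y | y 2 = z₀ ∧ d y = r'} with hS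
  have hSc : IsCompact S := by
    refine Metric.isCompact_of_isClosed_isBounded ?_ ?_
    · rw [hS, Set.setOf_and]
      exact (isClosed_eq (EuclideanSpace.proj (𝕜 := ℝ) (2 : Fin 3)).continuous continuous_const).inter
        (isClosed_eq hdc continuous_const)
    · refine (isBounded_iff_subset_closedBall 0).2 ⟨R + r' + 3, fun y hy => mem_closedBall_zero_iff.2 ?_⟩
      exact hnorm y (by rw [hy.2]; linarith) (by rw [hy.1, sub_self, abs_zero]; exact zero_le_one)
  obtain ⟨η, hη, hηS⟩ : ∃ η : ℝ, 0 < η ∧ ∀ y ∈ S, η ≤ |ψ y - c₀| := by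
    rcases S.eq_empty_or_nonempty with hSe | hSne
    · exact ⟨1, one_pos, fun y hy => by rw [hSe] at hy; exact absurd hy (Set.notMem_empty y)⟩
    · have hgc : ContinuousOn (fun y => |ψ y - c₀|) S := ((hψc.sub continuous_const).abs).continuousOn
      obtain ⟨ym, hym, hmin⟩ := hSc.exists_isMinOn hSne hgc
      refine ⟨|ψ ym - c₀|, abs_pos.2 (sub_ne_zero.2 (hsphere ym hym.1 hym.2)), fun y hy => hmin hy⟩
  -- uniform continuity of `ψ` on the compact solid tube `Q`
  set Q : Set (EuclideanSpace ℝ (Fin 3)) := {y | d y ≤ r' ∧ |y 2 - z₀| ≤ 1} with hQ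
  have hQc : IsCompact Q := by
    refine Metric.isCompact_of_isClosed_isBounded ?_ ?_
    · rw [hQ, Set.setOf_and]
      exact (isClosed_le hdc continuous_const).inter (isClosed_le (continuous_abs.comp
        ((EuclideanSpace.proj (𝕜 := ℝ) (2 : Fin 3)).continuous.sub continuous_const)) continuous_const)
    · refine (isBounded_iff_subset_closedBall 0).2 ⟨R + r' + 3, fun y hy => mem_closedBall_zero_iff.2 ?_⟩
      exact hnorm y (by linarith [hy.1]) hy.2
  have huc := hQc.uniformContinuousOn_of_continuous hψc.continuousOn
  rw [Metric.uniformContinuousOn_iff] at huc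
  -- (3) the normal segment at `γ 0`
  set p₀ := γ 0 with hp₀
  set D0 : ℝ := fderiv ℝ ψ p₀ (EuclideanSpace.single 0 1) with hD0
  set D1 : ℝ := fderiv ℝ ψ p₀ (EuclideanSpace.single 1 1) with hD1
  set n : EuclideanSpace ℝ (Fin 3) := D0 • EuclideanSpace.single 0 1 + D1 • EuclideanSpace.single 1 1 with hn
  have hn2 : n 2 = 0 := by simp [hn]
  have hm : fderiv ℝ ψ p₀ n = D0 ^ 2 + D1 ^ 2 := by
    rw [hn, map_add, map_smul, map_smul, ← hD0, ← hD1, smul_eq_mul, smul_eq_mul]; ring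
  have hmpos : 0 < D0 ^ 2 + D1 ^ 2 := by
    have h : D0 ≠ 0 ∨ D1 ≠ 0 := by
      by_contra hcon
      push Not at hcon
      apply hreg 0
      ext k; fin_cases k
      · simpa [hXψ0, ← hp₀, ← hD1] using hcon.2
      · simpa [hXψ1, ← hp₀, ← hD0] using hcon.1
      · simpa using hX2 (γ 0)
    rcases h with h | h
    · have := sq_pos_of_ne_zero h; positivity
    · have := sq_pos_of_ne_zero h; positivity
  set g : ℝ → ℝ := fun σ => ψ (p₀ + σ • n) with hg
  have hg0 : g 0 = c₀ := by simp [hg, hc₀, hp₀]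
  have hgd : HasDerivAt g (D0 ^ 2 + D1 ^ 2) 0 := by
    have hl : HasDerivAt (fun σ : ℝ => p₀ + σ • n) n 0 := by
      simpa using ((hasDerivAt_id (0 : ℝ)).smul_const n).const_add p₀
    have h := (hψd (p₀ + (0 : ℝ) • n)).hasFDerivAt.comp_hasDerivAt (0 : ℝ) hl
    simp only [zero_smul, add_zero] at h
    rwa [hm] at h
  -- `σ₀` with `σ₀ ‖n‖ < r'/2` and strict signs at the ends
  obtain ⟨σ₀, hσ₀, hσ₀b, hgm, hgp⟩ := exists_lt_lt_of_hasDerivAt_pos hgd hmpos (b := r' / (2 * (‖n‖ + 1))) (by positivity)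
  have hσn : σ₀ * ‖n‖ < r' / 2 := by
    have h1 : σ₀ * (‖n‖ + 1) < r' / 2 := by
      have := (lt_div_iff₀ (by positivity : (0:ℝ) < 2 * (‖n‖ + 1))).1 hσ₀b
      linarith
    nlinarith [norm_nonneg n]
  rw [hg0] at hgm hgp
  set η' : ℝ := min (g σ₀ - c₀) (c₀ - g (-σ₀)) with hη'
  have hη'pos : 0 < η' := lt_min (by linarith) (by linarith)
  -- segment points are inside the tube: `d (p₀ + σ n + w e2) ≤ σ₀ ‖n‖`
  have hdseg : ∀ σ ∈ Set.Icc (-σ₀) σ₀, ∀ w : ℝ, d (p₀ + σ • n + w • e2) ≤ σ₀ * ‖n‖ := by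
    intro σ hσ w
    have h1 : d (p₀ + σ • n + w • e2) = infDist (p₀ + σ • n) Λ := by
      simp only [hd, hPshift]
      rw [hPfix _ (by simpa [hn2, hp₀] using hz₀.symm)]
    rw [h1]
    have h2 : infDist (p₀ + σ • n) Λ ≤ dist (p₀ + σ • n) p₀ := infDist_le_dist_of_mem ⟨0, rfl⟩
    have h3 : dist (p₀ + σ • n) p₀ = |σ| * ‖n‖ := by rw [dist_eq_norm]; simp [norm_smul]
    have h4 : |σ| ≤ σ₀ := abs_le.2 ⟨hσ.1, hσ.2⟩
    nlinarith [norm_nonneg n]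
  have hseg2 : ∀ σ w : ℝ, (p₀ + σ • n + w • e2) 2 = z₀ + w := fun σ w => by
    simpa [hn2, he2, hp₀] using hz₀.symm
  -- (4) the radius `δ`
  obtain ⟨δ₁, hδ₁, huc₁⟩ := huc (η / 2) (by positivity)
  obtain ⟨δ₂, hδ₂, huc₂⟩ := huc (η' / 2) (by positivity)
  set δ : ℝ := min (min δ₁ δ₂) (min r' 1) with hδ
  have hδpos : 0 < δ := lt_min (lt_min hδ₁ hδ₂) (lt_min hr'pos one_pos)
  have hδ₁' : δ ≤ δ₁ := (min_le_left _ _).trans (min_le_left _ _)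
  have hδ₂' : δ ≤ δ₂ := (min_le_left _ _).trans (min_le_right _ _)
  have hδr : δ ≤ r' := (min_le_right _ _).trans (min_le_left _ _)
  have hδ1 : δ ≤ 1 := (min_le_right _ _).trans (min_le_right _ _)
  refine ⟨δ, hδpos, fun z hz => ?_⟩
  set w : ℝ := z - z₀ with hw
  have hwlt : |w| < δ := hz
  -- (3') the level point `p_z` on the shifted segment
  have hsegQ : ∀ σ ∈ Set.Icc (-σ₀) σ₀, ∀ w' : ℝ, |w'| ≤ 1 → p₀ + σ • n + w' • e2 ∈ Q := fun σ hσ w' hw' =>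
    ⟨by linarith [hdseg σ hσ w'], by rw [hseg2]; simpa using hw'⟩
  have hclose : ∀ σ ∈ Set.Icc (-σ₀) σ₀, |ψ (p₀ + σ • n + w • e2) - g σ| < η' / 2 := by
    intro σ hσ
    have h0 : p₀ + σ • n + (0 : ℝ) • e2 = p₀ + σ • n := by simp
    have h := huc₂ (p₀ + σ • n + w • e2) (hsegQ σ hσ w (by linarith [hwlt.le])) (p₀ + σ • n + (0 : ℝ) • e2)
      (hsegQ σ hσ 0 (by simp)) (by
        rw [dist_eq_norm]; simp only [h0, add_sub_cancel_left, norm_smul, Real.norm_eq_abs]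
        simp [he2]; exact lt_of_lt_of_le hwlt hδ₂')
    rw [h0, Real.dist_eq] at h
    exact h
  have hψcseg : ContinuousOn (fun σ : ℝ => ψ (p₀ + σ • n + w • e2)) (Set.Icc (-σ₀) σ₀) :=
    (hψc.comp (by fun_prop)).continuousOn
  obtain ⟨σs, hσs, hψσs⟩ : ∃ σs ∈ Set.Icc (-σ₀) σ₀, ψ (p₀ + σs • n + w • e2) = c₀ := by
    have hlo : ψ (p₀ + (-σ₀) • n + w • e2) < c₀ := by
      have h := hclose (-σ₀) ⟨le_rfl, by linarith⟩
      rw [abs_lt] at h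
      have : η' ≤ c₀ - g (-σ₀) := min_le_right _ _
      linarith
    have hhi : c₀ < ψ (p₀ + σ₀ • n + w • e2) := by
      have h := hclose σ₀ ⟨by linarith, le_rfl⟩
      rw [abs_lt] at h
      have : η' ≤ g σ₀ - c₀ := min_le_left _ _
      linarith
    exact intermediate_value_Icc (by linarith) hψcseg ⟨hlo.le, hhi.le⟩
  set pz : EuclideanSpace ℝ (Fin 3) := p₀ + σs • n + w • e2 with hpz
  have hpz2 : pz 2 = z := by rw [hpz, hseg2, hw]; ring
  have hpzd : d pz < r' := by have := hdseg σs hσs w; rw [← hpz] at this; linarith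
  -- (4') the isolated compact hot piece of `f = -(ψ - c₀)²` in the plane `P_z`
  set f : EuclideanSpace ℝ (Fin 3) → ℝ := fun y => -((ψ y - c₀) * (ψ y - c₀)) with hf
  have hf3 : ContDiff ℝ 3 f := ((hψ3.sub contDiff_const).mul (hψ3.sub contDiff_const)).neg
  have hfX : ∀ y, fderiv ℝ f y (X y) = 0 := by
    intro y
    have h1 : HasFDerivAt (fun y => ψ y - c₀) (fderiv ℝ ψ y) y := (hψd y).hasFDerivAt.sub_const c₀
    have h2 : HasFDerivAt f (-((ψ y - c₀) • fderiv ℝ ψ y + (ψ y - c₀) • fderiv ℝ ψ y)) y := (h1.mul h1).neg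
    rw [h2.fderiv]
    simp [hψX y]
  set K : Set (EuclideanSpace ℝ (Fin 3)) := {y | y 2 = z ∧ d y ≤ r' ∧ ψ y = c₀} with hK
  set O : Set (EuclideanSpace ℝ (Fin 3)) := {y | d y < r'} with hO
  have hOo : IsOpen O := isOpen_lt hdc continuous_const
  have hzabs : |z - z₀| < δ := by rw [← hw]; exact hwlt
  have hKc : IsCompact K := by
    refine Metric.isCompact_of_isClosed_isBounded ?_ ?_
    · rw [hK, Set.setOf_and, Set.setOf_and]
      exact (isClosed_eq (EuclideanSpace.proj (𝕜 := ℝ) (2 : Fin 3)).continuous continuous_const).inter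
        ((isClosed_le hdc continuous_const).inter (isClosed_eq hψc continuous_const))
    · refine (isBounded_iff_subset_closedBall 0).2 ⟨R + r' + 3, fun y hy => mem_closedBall_zero_iff.2 ?_⟩
      exact hnorm y (by linarith [hy.2.1]) (by rw [hy.1]; linarith [hzabs.le])
  have hKO : K ⊆ O := by
    intro y hy
    rcases (hy.2.1).lt_or_eq with hlt | heq
    · exact hlt
    · exfalso
      -- `P y` lies on the tube sphere: `|ψ (P y) - c₀| ≥ η`, but `ψ y = c₀` and `ψ` moves by `< η/2`
      have hPyS : P y ∈ S := ⟨hP2 y, by rw [hdP]; exact heq⟩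
      have h1 := hηS (P y) hPyS
      have hyQ : y ∈ Q := ⟨hy.2.1, by rw [hy.1]; linarith [hzabs.le]⟩
      have hPyQ : P y ∈ Q := ⟨by rw [hdP]; exact hy.2.1, by rw [hP2, sub_self, abs_zero]; exact zero_le_one⟩
      have h2 := huc₁ y hyQ (P y) hPyQ (by rw [hPdist, hy.1]; exact lt_of_lt_of_le hzabs hδ₁')
      rw [Real.dist_eq, hy.2.2] at h2
      rw [abs_sub_comm] at h2
      linarith
  obtain ⟨γ', ℓ', hℓ', hγ', hper', hne', hγ'2, -⟩ :=
    exists_periodic_orbit_of_isolated_hot_piece_located (X := X) hXc hX2 hf3 hfX (N := 0) (y₀ := pz) (K := K) (O := O)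
      hKc ⟨hpz2, hpzd.le, hψσs⟩ (fun y hy => ⟨by rw [hy.1, hpz2], by simp [hf, hy.2.2]⟩) hOo hKO
      (fun y _ _ => by simp only [hf]; nlinarith [mul_self_nonneg (ψ y - c₀)])
      (fun y hyO hy2 hfy => by
        have h0 : (ψ y - c₀) * (ψ y - c₀) = 0 := by simp only [hf] at hfy; linarith
        have : ψ y = c₀ := by rcases mul_eq_zero.1 h0 with h | h <;> linarith
        exact ⟨by rw [hy2, hpz2], le_of_lt hyO, this⟩)
      (fun y hyO hy2 _ => hXtube y (le_of_lt hyO) (by rw [hy2, hpz2]; linarith [hzabs.le]))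
  exact ⟨γ', ℓ', hℓ', hγ', hper', by rw [hγ'2, hpz2], hne'⟩

end Summit.NavierStokesRegularity.NavierStokesRegularity.Theorems.PoloidalWindowDoorPoloidalWindowRigidityLoopsPersist
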